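/-
Origin: expansion seat `planner-pub-hodgecm-pv03-g6-0`, handover #5 v2 2026-08-18T11:09:41Z (`HOME/pub-hodgecm-pv03-g6/lean/Pv03g6/TwistedTypeNorm.lean`, md5 4f85103e, 405 lines);
landed by the gen-7 packager in gate run 28 as `HodgeCM/Model/Toy/TwistedTypeNorm.lean` (verbatim).
-/
/-
Copyright (c) 2026. Released under Apache 2.0 license as described in the file LICENSE.
-/
import Mathlib
import Summits.HodgeConjecture.HodgeCM.Model.Toy.EigenBasis_2

/-!
# Galois hull of a toy object and the twisted type norms

Origin: seat `planner-pub-hodgecm-pv03-g6-0` (unit `pub-hodgecm-pv03-g6`, DAG-node prover #03, gen 6), 2026-08-18;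
WIP module `Pv03g6.TwistedTypeNorm`, final module `HodgeCM.Model.Toy.TwistedTypeNorm` (kind L5, toy model /
consistency witness; generation-1 objects only, hence `Model/Toy/`). Memo: `HOME/pub-hodgecm-pv03-g6/SPLIT-ALL-GOOD.md`.

For a generation-1 object `X` (atoms `(F_i, Φ_i)`, `F_i ⊂ ℂ` finite, `Φ_i` one embedding per conjugate
pair — NOT necessarily a CM field) we construct

* `X.N ⊂ ℂ`, a finite Galois extension of `ℚ` containing `ψ(F_i)` for every atom `i` and every
  embedding `ψ : F_i →+* ℂ` (the splitting field of the product of the minimal polynomials of chosen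
  primitive elements), with the corestrictions `X.toN i ψ : F_i →+* X.N`;
* for `δ ∈ Gal(X.N/ℚ)` the **twisted index** `X.twist δ s` of an eigen-index `s = ⟨i, σ⟩`
  (`σ ↦ δ ∘ σ`), and the twisted holomorphy predicate `X.holTw δ s :⇔ δ⁻¹ ∘ σ ∈ Φ_i`
  (`⇔ σ ∈ δΦ_i`; for `δ = 1` this is `X.hol s`);
* for `α ∈ X.N` the **twisted type norm** `X.tnorm α : X.L` (`= (g_{α,i})_i`, `g_{α,i} ∈ F_i`), defined
  Galois-theoretically by `g_{α,i} := ∏_{φ ∈ Φ_i} φ⁻¹( ∏_{h ∈ Gal(N/φF_i)} h α )`, and its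
  EMBEDDING FORMULA (`Obj.emb_tnorm`):
      `σ (g_{α,i}) = ∏_{δ ∈ Gal(N/ℚ), δ⁻¹∘σ ∈ Φ_i} δ α`.

Consequently multiplication by `X.tnorm α` is a rational endomorphism of `L X` whose complexification is
diagonal on the eigenbasis `eB` with eigenvalue `ev (tnorm α) s = ∏_{δ : holTw δ s} δ α` at `s` (`Obj.mulL_eB`,
`Obj.ev_tnorm`), regrouped as `∏_j ev (tnorm α) (g j) = ∏_δ (δ α) ^ cntTw δ g` (`Obj.prod_ev_tnorm`) with
`∏_δ δ α = N_{N/ℚ}(α)` (`Obj.prod_gal_apply`); for `α ≠ 0` it is invertible (`Obj.mulLEquiv`).  These are the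
operators that feed `ToyG2.EigenSplit.rightSplit_of_diag` for ALL good generation-2 objects (CM or not):
the two remaining hypotheses are supplied by `HodgeCM.Model.ToyG2.TwistedNormTrace` (`hR`, Lemma A) and
`HodgeCM.Model.Toy.TwistedNormSep` (`hsep`), assembled in `HodgeCM.Model.ToyG2.SplitAllGood`.
-/

noncomputable section

open Polynomial IntermediateField

namespace HodgeCM.Toy

attribute [local instance] Classical.propDecidable

namespace Obj

variable (X : Obj)

/-! ### §1 The Galois hull `X.N ⊂ ℂ` -/

/-- a primitive element of the atom field `F_i` -/
def pbA (i : X.s.toType) : PowerBasis ℚ (X.atom i).F := Field.powerBasisOfFiniteOfSeparable ℚ _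

/-- the product of the minimal polynomials of the chosen primitive elements -/
def polA : ℚ[X] := ∏ i, minpoly ℚ (X.pbA i).gen

/-- (Ported verbatim from the HodgeCMPerL package; no docstring in the source.) -/
lemma polA_ne_zero : X.polA ≠ 0 :=
  Finset.prod_ne_zero_iff.mpr fun i _ => minpoly.ne_zero (X.pbA i).isIntegral_gen

/-- the complex roots of `polA` -/
abbrev SA : Set ℂ := X.polA.rootSet ℂ

/-- **the Galois hull** `X.N = ℚ(SA) ⊂ ℂ` -/
abbrev N : IntermediateField ℚ ℂ := IntermediateField.adjoin ℚ X.SA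

/-- (Ported verbatim from the HodgeCMPerL package; no docstring in the source.) -/
instance N_isSplittingField : X.polA.IsSplittingField ℚ X.N :=
  adjoin_rootSet_isSplittingField (IsAlgClosed.splits _)

/-- (Ported verbatim from the HodgeCMPerL package; no docstring in the source.) -/
instance N_normal : Normal ℚ X.N := Normal.of_isSplittingField X.polA

/-- (Ported verbatim from the HodgeCMPerL package; no docstring in the source.) -/
instance N_finiteDimensional : FiniteDimensional ℚ X.N :=
  IsSplittingField.finiteDimensional X.N X.polA

/-- (Ported verbatim from the HodgeCMPerL package; no docstring in the source.) -/
instance N_numberField : NumberField X.N := NumberField.mk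

/-- (Ported verbatim from the HodgeCMPerL package; no docstring in the source.) -/
instance N_isGalois : IsGalois ℚ X.N := IsGalois.mk

/-- Every embedding of every atom field lands in `X.N`. -/
lemma apply_mem (i : X.s.toType) (ψ : (X.atom i).F →+* ℂ) (x : (X.atom i).F) : ψ x ∈ X.N := by
  obtain ⟨q, rfl⟩ := (X.pbA i).exists_eq_aeval' x
  have hg : ψ (X.pbA i).gen ∈ X.N := by
    refine subset_adjoin ℚ X.SA ?_
    rw [mem_rootSet_of_ne X.polA_ne_zero, polA, map_prod]
    refine Finset.prod_eq_zero (Finset.mem_univ i) ?_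
    have h := minpoly.aeval ℚ (X.pbA i).gen
    have : aeval (ψ.toRatAlgHom (X.pbA i).gen) (minpoly ℚ (X.pbA i).gen) = 0 := by
      rw [aeval_algHom_apply, h, map_zero]
    simpa using this
  have e : ψ (aeval (X.pbA i).gen q) = aeval (ψ (X.pbA i).gen) q := by
    have := (aeval_algHom_apply ψ.toRatAlgHom (X.pbA i).gen q).symm
    simpa using this
  rw [e, show ψ (X.pbA i).gen = ((⟨ψ (X.pbA i).gen, hg⟩ : X.N) : ℂ) from rfl, aeval_coe]
  exact SetLike.coe_mem _

/-- An embedding `ψ : F_i →+* ℂ` corestricted to `X.N`. -/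
def toN (i : X.s.toType) (ψ : (X.atom i).F →+* ℂ) : (X.atom i).F →+* X.N :=
  ψ.codRestrict X.N (X.apply_mem i ψ)

/-- (Ported verbatim from the HodgeCMPerL package; no docstring in the source.) -/
@[simp] lemma coe_toN (i : X.s.toType) (ψ : (X.atom i).F →+* ℂ) (x : (X.atom i).F) :
    ((X.toN i ψ x : X.N) : ℂ) = ψ x := rfl

/-- (Ported verbatim from the HodgeCMPerL package; no docstring in the source.) -/
lemma val_comp_toN (i : X.s.toType) (ψ : (X.atom i).F →+* ℂ) :
    (algebraMap X.N ℂ : X.N →+* ℂ).comp (X.toN i ψ) = ψ := by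
  ext x; rfl

/-- (Ported verbatim from the HodgeCMPerL package; no docstring in the source.) -/
lemma toN_injective (i : X.s.toType) : Function.Injective (X.toN i) := by
  intro ψ ψ' h
  rw [← X.val_comp_toN i ψ, h, X.val_comp_toN]

/-- the Galois group of the hull -/
abbrev G : Type := X.N ≃ₐ[ℚ] X.N

/-! ### §2 Twisted indices -/

/-- the twisted eigen-index `δ • ⟨i, σ⟩ := ⟨i, δ ∘ σ⟩` -/
def twist (δ : X.G) (s : X.Idx) : X.Idx :=
  ⟨s.1, (algebraMap X.N ℂ : X.N →+* ℂ).comp ((δ : X.N →+* X.N).comp (X.toN s.1 s.2))⟩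

/-- (Ported verbatim from the HodgeCMPerL package; no docstring in the source.) -/
@[simp] lemma twist_fst (δ : X.G) (s : X.Idx) : (X.twist δ s).1 = s.1 := rfl

/-- (Ported verbatim from the HodgeCMPerL package; no docstring in the source.) -/
lemma twist_snd_apply (δ : X.G) (s : X.Idx) (x : (X.atom s.1).F) :
    (X.twist δ s).2 x = ((δ (X.toN s.1 s.2 x) : X.N) : ℂ) := rfl

/-- (Ported verbatim from the HodgeCMPerL package; no docstring in the source.) -/
lemma toN_twist (δ : X.G) (s : X.Idx) :
    X.toN s.1 (X.twist δ s).2 = (δ : X.N →+* X.N).comp (X.toN s.1 s.2) := by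
  ext x
  rfl

/-- (Ported verbatim from the HodgeCMPerL package; no docstring in the source.) -/
@[simp] lemma twist_one (s : X.Idx) : X.twist 1 s = s := by
  obtain ⟨i, σ⟩ := s
  simp only [twist, Sigma.mk.injEq, heq_eq_eq, true_and]
  ext x; rfl

/-- (Ported verbatim from the HodgeCMPerL package; no docstring in the source.) -/
lemma twist_mul (δ δ' : X.G) (s : X.Idx) : X.twist (δ * δ') s = X.twist δ (X.twist δ' s) := by
  obtain ⟨i, σ⟩ := s
  simp only [twist, Sigma.mk.injEq, heq_eq_eq, true_and]
  ext x; rfl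

/-- (Ported verbatim from the HodgeCMPerL package; no docstring in the source.) -/
lemma twist_inv_twist (δ : X.G) (s : X.Idx) : X.twist δ⁻¹ (X.twist δ s) = s := by
  rw [← twist_mul, inv_mul_cancel, twist_one]

/-- (Ported verbatim from the HodgeCMPerL package; no docstring in the source.) -/
lemma twist_twist_inv (δ : X.G) (s : X.Idx) : X.twist δ (X.twist δ⁻¹ s) = s := by
  rw [← twist_mul, mul_inv_cancel, twist_one]

/-- twisted holomorphy: `holTw δ ⟨i, σ⟩ :⇔ δ⁻¹ ∘ σ ∈ Φ_i` (i.e. `σ ∈ δ Φ_i`); `holTw 1 = hol`. -/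
def holTw (δ : X.G) (s : X.Idx) : Prop := X.hol (X.twist δ⁻¹ s)

/-- (Ported verbatim from the HodgeCMPerL package; no docstring in the source.) -/
lemma holTw_one (s : X.Idx) : X.holTw 1 s ↔ X.hol s := by
  rw [holTw, inv_one, twist_one]

/-! ### §3 The twisted type norm -/

section tnorm

variable (i : X.s.toType) (φ : (X.atom i).F →+* ℂ)

/-- the subfield `φ(F_i) ⊆ X.N` -/
def rangeN : IntermediateField ℚ X.N := (X.toN i φ).toRatAlgHom.fieldRange

/-- (Ported verbatim from the HodgeCMPerL package; no docstring in the source.) -/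
lemma mem_rangeN_iff (y : X.N) : y ∈ X.rangeN i φ ↔ ∃ x, X.toN i φ x = y := by
  simp [rangeN, AlgHom.mem_fieldRange]

/-- `Gal(X.N / φ(F_i))` as a subgroup of `Gal(X.N/ℚ)` -/
def stabN : Subgroup X.G := (X.rangeN i φ).fixingSubgroup

/-- (Ported verbatim from the HodgeCMPerL package; no docstring in the source.) -/
lemma mem_stabN_iff (h : X.G) : h ∈ X.stabN i φ ↔ ∀ x, h (X.toN i φ x) = X.toN i φ x := by
  rw [stabN, IntermediateField.mem_fixingSubgroup_iff]
  constructor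
  · intro H x; exact H _ ((X.mem_rangeN_iff i φ _).mpr ⟨x, rfl⟩)
  · rintro H y hy
    obtain ⟨x, rfl⟩ := (X.mem_rangeN_iff i φ y).mp hy
    exact H x

/-- the elements of `Gal(X.N / φ(F_i))`, as a finset -/
def stabSet : Finset X.G := Finset.univ.filter (fun h => h ∈ X.stabN i φ)

/-- (Ported verbatim from the HodgeCMPerL package; no docstring in the source.) -/
lemma mem_stabSet_iff (h : X.G) : h ∈ X.stabSet i φ ↔ ∀ x, h (X.toN i φ x) = X.toN i φ x := by
  rw [stabSet, Finset.mem_filter, mem_stabN_iff]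
  simp

/-- the relative norm `∏_{h ∈ Gal(N/φF_i)} h α` -/
def normStab (α : X.N) : X.N := ∏ h ∈ X.stabSet i φ, h α

/-- (Ported verbatim from the HodgeCMPerL package; no docstring in the source.) -/
lemma normStab_mem (α : X.N) : X.normStab i φ α ∈ X.rangeN i φ := by
  rw [← IsGalois.fixedField_fixingSubgroup (X.rangeN i φ), IntermediateField.mem_fixedField_iff]
  intro f hf
  rw [normStab, map_prod]
  have hf' : ∀ x, f (X.toN i φ x) = X.toN i φ x := (X.mem_stabN_iff i φ f).mp hf
  -- reindex the product by left multiplication with `f`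
  refine Finset.prod_equiv (Equiv.mulLeft f) (fun h => ?_) (fun h _ => ?_)
  · simp only [Equiv.coe_mulLeft, mem_stabSet_iff]
    constructor
    · intro H x; rw [AlgEquiv.mul_apply, H x, hf' x]
    · intro H x
      have := H x
      rw [AlgEquiv.mul_apply] at this
      exact f.injective (this.trans (hf' x).symm)
  · simp [AlgEquiv.mul_apply]

/-- (Ported verbatim from the HodgeCMPerL package; no docstring in the source.) -/
lemma exists_tnormAt (α : X.N) : ∃ x : (X.atom i).F, X.toN i φ x = X.normStab i φ α :=
  (X.mem_rangeN_iff i φ _).mp (X.normStab_mem i φ α)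

/-- `φ⁻¹ (∏_{h ∈ Gal(N/φF_i)} h α) ∈ F_i` -/
def tnormAt (α : X.N) : (X.atom i).F := Classical.choose (X.exists_tnormAt i φ α)

/-- (Ported verbatim from the HodgeCMPerL package; no docstring in the source.) -/
lemma toN_tnormAt (α : X.N) : X.toN i φ (X.tnormAt i φ α) = X.normStab i φ α :=
  Classical.choose_spec (X.exists_tnormAt i φ α)

end tnorm

/-- **the twisted type norm** `g_α = (∏_{φ ∈ Φ_i} φ⁻¹ N_{N/φF_i}(α))_i ∈ L X` -/
def tnorm (α : X.N) : X.L := fun i =>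
  ∏ φ ∈ Finset.univ.filter (fun φ => φ ∈ (X.atom i).Φ), X.tnormAt i φ α


/-! ### §4 The embedding formula -/

/-- Two embeddings of an atom field into the Galois hull differ by an element of the Galois group. -/
lemma exists_gal_comp (i : X.s.toType) (φ τ : (X.atom i).F →+* ℂ) :
    ∃ δ₀ : X.G, ∀ x, δ₀ (X.toN i φ x) = X.toN i τ x := by
  letI : Algebra (X.atom i).F X.N := (X.toN i φ).toAlgebra
  haveI : IsScalarTower ℚ (X.atom i).F X.N :=
    IsScalarTower.of_algebraMap_eq' (Subsingleton.elim _ _)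
  let ϕ : (X.atom i).F →ₐ[ℚ] X.N := (X.toN i τ).toRatAlgHom
  let ψ : X.N →ₐ[ℚ] X.N := ϕ.liftNormal X.N
  refine ⟨AlgEquiv.ofBijective ψ (Algebra.IsAlgebraic.algHom_bijective ψ), fun x => ?_⟩
  rw [AlgEquiv.ofBijective_apply]
  have h := AlgHom.liftNormal_commutes ϕ X.N x
  rw [Algebra.algebraMap_self, RingHom.id_apply] at h
  exact h

variable {X} in
/-- (Ported verbatim from the HodgeCMPerL package; no docstring in the source.) -/
lemma inv_comp_eq_iff (δ : X.G) {i : X.s.toType} (φ τ : (X.atom i).F →+* ℂ) :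
    (∀ x, δ⁻¹ (X.toN i τ x) = X.toN i φ x) ↔ ∀ x, δ (X.toN i φ x) = X.toN i τ x := by
  constructor
  · intro H x
    rw [← H x, ← AlgEquiv.mul_apply, mul_inv_cancel, AlgEquiv.one_apply]
  · intro H x
    rw [← H x, ← AlgEquiv.mul_apply, inv_mul_cancel, AlgEquiv.one_apply]

/-- `twist δ⁻¹ ⟨i, τ⟩ = ⟨i, φ⟩` in terms of `toN` -/
lemma twist_inv_snd_eq_iff (δ : X.G) (s : X.Idx) (φ : (X.atom s.1).F →+* ℂ) :
    (X.twist δ⁻¹ s).2 = φ ↔ ∀ x, δ (X.toN s.1 φ x) = X.toN s.1 s.2 x := by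
  rw [← inv_comp_eq_iff]
  constructor
  · intro H x
    apply Subtype.ext
    have := congrArg (fun f : (X.atom s.1).F →+* ℂ => f x) H
    exact this
  · intro H
    ext x
    change (((δ⁻¹ (X.toN s.1 s.2 x)) : X.N) : ℂ) = φ x
    rw [H x]
    rfl

/-- (Ported verbatim from the HodgeCMPerL package; no docstring in the source.) -/
lemma holTw_iff (δ : X.G) (s : X.Idx) : X.holTw δ s ↔ (X.twist δ⁻¹ s).2 ∈ (X.atom s.1).Φ := Iff.rfl

/-- (Ported verbatim from the HodgeCMPerL package; no docstring in the source.) -/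
lemma coe_eq_algebraMap (y : X.N) : ((y : X.N) : ℂ) = algebraMap X.N ℂ y := rfl

/-- the embedding formula for one factor `φ⁻¹ N_{N/φF_i}(α)`:
`τ (φ⁻¹ N(α)) = ∏_{δ : δ⁻¹ ∘ τ = φ} δ α` -/
lemma emb_tnormAt (α : X.N) (s : X.Idx) (φ : (X.atom s.1).F →+* ℂ) :
    s.2 (X.tnormAt s.1 φ α)
      = ∏ δ ∈ Finset.univ.filter (fun δ : X.G => (X.twist δ⁻¹ s).2 = φ), ((δ α : X.N) : ℂ) := by
  obtain ⟨δ₀, h₀⟩ := X.exists_gal_comp s.1 φ s.2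
  have e1 : s.2 (X.tnormAt s.1 φ α) = ((δ₀ (X.normStab s.1 φ α) : X.N) : ℂ) := by
    rw [← toN_tnormAt, h₀, coe_toN]
  rw [e1, normStab, map_prod, coe_eq_algebraMap, map_prod]
  refine Finset.prod_equiv (Equiv.mulLeft δ₀) (fun h => ?_) (fun h _ => ?_)
  · rw [Equiv.coe_mulLeft, Finset.mem_filter, twist_inv_snd_eq_iff, mem_stabSet_iff]
    simp only [Finset.mem_univ, true_and, AlgEquiv.mul_apply]
    constructor
    · intro H x; rw [H x, h₀ x]
    · intro H x; exact δ₀.injective ((H x).trans (h₀ x).symm)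
  · rw [Equiv.coe_mulLeft, AlgEquiv.mul_apply]; rfl

/-- **Embedding formula.** `σ (g_{α,i}) = ∏_{δ ∈ Gal(N/ℚ) : δ⁻¹ ∘ σ ∈ Φ_i} δ α`. -/
theorem emb_tnorm (α : X.N) (s : X.Idx) :
    s.2 (X.tnorm α s.1) = ∏ δ ∈ Finset.univ.filter (fun δ : X.G => X.holTw δ s), ((δ α : X.N) : ℂ) := by
  rw [tnorm, map_prod]
  have step : ∀ φ ∈ Finset.univ.filter (fun φ => φ ∈ (X.atom s.1).Φ),
      s.2 (X.tnormAt s.1 φ α) = ∏ δ ∈ (Finset.univ.filter (fun δ : X.G => X.holTw δ s)).filter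
        (fun δ => (X.twist δ⁻¹ s).2 = φ), ((δ α : X.N) : ℂ) := by
    intro φ hφ
    rw [emb_tnormAt, Finset.filter_filter]
    refine Finset.prod_congr ?_ (fun _ _ => rfl)
    ext δ
    simp only [Finset.mem_filter, Finset.mem_univ, true_and, holTw_iff]
    constructor
    · intro h; rw [h]; exact ⟨(Finset.mem_filter.mp hφ).2, rfl⟩
    · exact fun h => h.2
  rw [Finset.prod_congr rfl step]
  exact Finset.prod_fiberwise_of_maps_to (fun δ hδ => by
    rw [Finset.mem_filter] at hδ ⊢; exact ⟨Finset.mem_univ _, (X.holTw_iff δ s).mp hδ.2⟩) _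

/-! ### §5 Multiplication operators are diagonal on the eigenbasis -/

/-- coordinatewise multiplication by `g ∈ L X = ∏ F_i` -/
def mulL (g : X.L) : X.L →ₗ[ℚ] X.L :=
  LinearMap.pi fun i => LinearMap.mulLeft ℚ (g i) ∘ₗ LinearMap.proj i

/-- (Ported verbatim from the HodgeCMPerL package; no docstring in the source.) -/
@[simp] lemma mulL_apply (g x : X.L) (i : X.s.toType) : X.mulL g x i = g i * x i := rfl

/-- (Ported verbatim from the HodgeCMPerL package; no docstring in the source.) -/
lemma mulL_comp_single (g : X.L) (i : X.s.toType) :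
    X.mulL g ∘ₗ LinearMap.single ℚ (fun j => ((X.atom j).F : Type)) i
      = LinearMap.single ℚ (fun j => ((X.atom j).F : Type)) i ∘ₗ LinearMap.mulLeft ℚ (g i) := by
  apply LinearMap.ext
  intro y
  ext j
  simp only [LinearMap.comp_apply, LinearMap.coe_single, mulL_apply, LinearMap.mulLeft_apply]
  by_cases h : j = i
  · subst h; simp
  · simp [Pi.single_eq_of_ne h]

/-- (Ported verbatim from the HodgeCMPerL package; no docstring in the source.) -/
lemma mulL_one : X.mulL 1 = LinearMap.id := by
  apply LinearMap.ext; intro x; ext i; simp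

/-- (Ported verbatim from the HodgeCMPerL package; no docstring in the source.) -/
lemma mulL_mul (g g' : X.L) : X.mulL (g * g') = X.mulL g ∘ₗ X.mulL g' := by
  apply LinearMap.ext; intro x; ext i; simp [mul_assoc]

/-- the eigenvalue of `g` at the eigen-index `s = ⟨i, σ⟩`: `σ (g_i)` -/
def ev (g : X.L) (s : X.Idx) : ℂ := s.2 (g s.1)

/-- `g ⊗ ℂ` is diagonal on the eigenbasis `eB` with eigenvalues `ev g`. -/
theorem mulL_eB (g : X.L) (s : X.Idx) :
    (X.mulL g).baseChange ℂ (X.eB s) = X.ev g s • X.eB s := by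
  rw [Obj.eB_apply', Obj.eT, ← LinearMap.comp_apply, ← LinearMap.baseChange_comp, mulL_comp_single,
    LinearMap.baseChange_comp, LinearMap.comp_apply, baseChange_mulLeft, tmul_mul_eps, map_smul]
  rfl

/-- the eigenvalue of the twisted type norm: `ev (tnorm α) s = ∏_{δ : holTw δ s} δ α` -/
theorem ev_tnorm (α : X.N) (s : X.Idx) :
    X.ev (X.tnorm α) s = ∏ δ ∈ Finset.univ.filter (fun δ : X.G => X.holTw δ s), ((δ α : X.N) : ℂ) :=
  X.emb_tnorm α s

/-! ### §6 Regrouping the eigenvalue of `⋀ᵏ (tnorm α)` by Galois elements -/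

/-- the number of slots `j` with `holTw δ (g j)`, i.e. `cnt (twist δ⁻¹ ∘ g)` -/
def cntTw (δ : X.G) {k : ℕ} (g : Fin k → X.Idx) : ℕ :=
  (Finset.univ.filter fun j => X.holTw δ (g j)).card

/-- (Ported verbatim from the HodgeCMPerL package; no docstring in the source.) -/
lemma cntTw_eq_cnt (δ : X.G) {k : ℕ} (g : Fin k → X.Idx) :
    X.cntTw δ g = X.cnt (fun j => X.twist δ⁻¹ (g j)) := by
  rw [cntTw, cnt_eq_card_filter]
  rfl

/-- (Ported verbatim from the HodgeCMPerL package; no docstring in the source.) -/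
lemma cntTw_one {k : ℕ} (g : Fin k → X.Idx) : X.cntTw 1 g = X.cnt g := by
  rw [cntTw_eq_cnt]
  simp only [inv_one, twist_one]


-- port_pkg: scope closed for this part
end Obj
end HodgeCM.Toy
end
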